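import Summits.NavierStokesRegularity.NavierStokesRegularity.Theorems.AxisymmetricExtremalityAxisymmetricKatoGlobalStubSeregin2020TypeIILemma22Assembly
import HarnessLib

/-!
# Seregin 2020, Lemma 2.2 (= `hWH′` of `blowupIndex_eq_top_of_weakHarnack'`): SKELETON, rev 2
# (re-targeted to the cell's cut of record, 2026-08-28 ≥ 09:30Z)

Crux workfile (cell pub/ns-inputs, seat ns-in-ser-a). NOT a Theorems file: the two `stub_*` below
are the open pieces; the composition is the LANDED assembly
`…Theorems/…StubSeregin2020TypeIILemma22Assembly.lean` (p621051).

* `stub_L31_moserSublevel` — the registered atom `lemma22_smallSublevel_lowerBound` (N–U Lemma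
  3.1 for the class, Moser iteration), VERBATIM; owner: ser-c's one-line closer on wu-p33 g2's
  registered `lemma22_moserStep` (`lemma22_smallSublevel_lowerBound_of_moserStep`, p620323, landed).
* `stub_L22B_energyClass` — L22-B, the energy class (N–U (3.3), Seregin §3) of the normalised pair
  `(Φ̃, Ũ)` across the axis and `S`, in the contract form kits/A1-assembly-hEC.md; owner: ser-b
  (`energyClass_acrossAxis_of_classV`, F3c) on es-p1's F2′/F3a/F3b.
* `lemma22_of_stubs : hWH′` and `seregin2020_typeII_of_stubs : Seregin2020_axisymmetricSingularPoint_typeII`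
  — kernel-checked compositions through `lemma22_of_moser_and_energyClass` /
  `seregin2020_typeII_of_moser_and_energyClass` (landed: L22-A `axis_measure_estimate` p620358,
  L22-C composition `lemma22_expansionOfPositivity_of_atoms` + atoms `lemma22_densityPropagation`,
  `lemma22_shrinking`).

Rev 1's `stub_L22A_measure_estimate` is CLOSED (`axis_measure_estimate`); rev 1's `stub_L22C_cor33`
was superseded by seat c's interface (kits/A1.md §2′) and is closed modulo `stub_L31_moserSublevel`.
No NS regularity statement is proved here.
-/

-- the problem directory repeats the summit name (D-0017); core's `dupNamespace` linter fires
set_option linter.dupNamespace false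

noncomputable section

open MeasureTheory Set Function Filter Topology TopologicalSpace Metric
open scoped NNReal ENNReal InnerProductSpace

namespace Summit.NavierStokesRegularity.NavierStokesRegularity.Theorems.AxisymmetricKatoGlobal.EulerScaling

open Literature.Analysis.FluidPDE Literature.Analysis.FluidPDE.Seregin2020
  Literature.Analysis.FluidPDE.SereginZajaczkowski2007

/-- **STUB L3.1′ (N–U 2012 Lemma 3.1 for the De Giorgi class; = registered
`lemma22_smallSublevel_lowerBound`, verbatim).** [cite: NazarovUraltseva2012, Lemma 3.1, Remark 6] -/
theorem stub_L31_moserSublevel : ∀ (lamlo θlo θhi : ℝ) (N : ℝ≥0), 1 < lamlo → lamlo ≤ 2 → 0 < θlo → θlo ≤ θhi →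
      ∃ μ₁ : ℝ, 0 < μ₁ ∧
      ∀ (Φ : ℝ → EuclideanSpace ℝ (Fin 3) → ℝ) (U : ℝ → EuclideanSpace ℝ (Fin 3) → EuclideanSpace ℝ (Fin 3))
        (S : Set (ℝ × EuclideanSpace ℝ (Fin 3))) (k R : ℝ), (0 < k ∧ 0 < R ∧ Measurable (uncurry Φ) ∧ AEStronglyMeasurable (uncurry U) volume ∧
          IsClosed S ∧ (∀ z ∈ S, cylRadius z.2 = 0) ∧ ContinuousOn (uncurry Φ) ({z : ℝ ×
          EuclideanSpace ℝ (Fin 3) | z.1 < 0} \ S) ∧ (∀ t x, 0 ≤ Φ t x) ∧ (∀ᵐ t : ℝ, t ∈ Ioo (-R ^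
          2) 0 → ContDiff ℝ 1 (Φ t)) ∧ (∫⁻ s in Ioo (-R ^ 2) 0, (∫⁻ y in ball (0 : EuclideanSpace ℝ
          (Fin 3)) (2 * R), ‖U s y‖ₑ ^ (3 : ℕ)) ^ (4 / 3 : ℝ) ≤ (N : ℝ≥0∞) * ENNReal.ofReal R ^ 2) ∧
          (∀ (H : ℝ → ℝ), ContDiff ℝ 2 H → (∀ v, deriv H v ≤ 0) → (∀ v, 0 ≤ H v) → (∀ v, 0 ≤ deriv
          (deriv H) v) → (∀ v, deriv H v ^ 2 ≤ 2 * H v * deriv (deriv H) v) → (∀ v, k ≤ v → H v = 0)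
          → ∀ (Θ : EuclideanSpace ℝ (Fin 3) → ℝ), ContDiff ℝ 1 Θ → HasCompactSupport Θ → tsupport Θ
          ⊆ ball (0 : EuclideanSpace ℝ (Fin 3)) (2 * R) → ∀ (η : ℝ → ℝ), ContDiff ℝ 1 η → (∀ s, 0 ≤
          η s) → ∀ (t₁ t₂ : ℝ), -R ^ 2 < t₁ → t₁ ≤ t₂ → t₂ < 0 → ENNReal.ofReal (η t₂ * ∫ x, H (Φ t₂
          x) * Θ x ^ 2) + ∫⁻ z in Icc t₁ t₂ ×ˢ (univ : Set (EuclideanSpace ℝ (Fin 3))),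
          ENNReal.ofReal (1 / 2 * η z.1 * (deriv (deriv H) (Φ z.1 z.2) * ‖gradient (Φ z.1) z.2‖ ^ 2
          * Θ z.2 ^ 2)) ≤ ENNReal.ofReal (η t₁ * (∫ x, H (Φ t₁ x) * Θ x ^ 2) + (4 * ∫ z in Icc t₁ t₂
          ×ˢ (univ : Set (EuclideanSpace ℝ (Fin 3))), η z.1 * (H (Φ z.1 z.2) * ‖gradient Θ z.2‖ ^
          2)) + (∫ z in Icc t₁ t₂ ×ˢ (univ : Set (EuclideanSpace ℝ (Fin 3))), η z.1 * (H (Φ z.1 z.2)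
          * inner ℝ (U z.1 z.2) (gradient (fun y => Θ y ^ 2) z.2))) + (∫ z in Icc t₁ t₂ ×ˢ (univ :
          Set (EuclideanSpace ℝ (Fin 3))), η z.1 * (2 / cylRadius z.2 * (H (Φ z.1 z.2) * fderiv ℝ
          (fun y => Θ y ^ 2) z.2 (eR z.2)))) + (∫ z in Icc t₁ t₂ ×ˢ (univ : Set (EuclideanSpace ℝ
          (Fin 3))), |deriv η z.1| * (H (Φ z.1 z.2) * Θ z.2 ^ 2))))) →
      ∀ (lam ρ θ t₀ l : ℝ), lamlo ≤ lam → lam ≤ 2 → R / 4 ≤ ρ → lam * ρ ≤ 2 * R → θlo ≤ θ → θ ≤ θhi →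
        t₀ ≤ 0 → -R ^ 2 < t₀ - θ * ρ ^ 2 → 0 < l → l ≤ k →
        volume {z : ℝ × EuclideanSpace ℝ (Fin 3) |
            z ∈ Ioo (t₀ - θ * ρ ^ 2) t₀ ×ˢ ball (0 : EuclideanSpace ℝ (Fin 3)) (lam * ρ) ∧ Φ z.1 z.2 < l}
          ≤ ENNReal.ofReal μ₁ * volume (Ioo (t₀ - θ * ρ ^ 2) t₀ ×ˢ ball (0 : EuclideanSpace ℝ (Fin 3)) (lam * ρ)) →
        (∀ᵐ z ∂(volume.restrict (Ioo (t₀ - θ / 2 * ρ ^ 2) t₀ ×ˢ ball (0 : EuclideanSpace ℝ (Fin 3)) ρ)),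
            l / 2 ≤ Φ z.1 z.2) ∧
        ((∀ᵐ x ∂(volume.restrict (ball (0 : EuclideanSpace ℝ (Fin 3)) (lam * ρ))), l ≤ Φ (t₀ - θ * ρ ^ 2) x) →
          ∀ᵐ z ∂(volume.restrict (Ioo (t₀ - θ * ρ ^ 2) t₀ ×ˢ ball (0 : EuclideanSpace ℝ (Fin 3)) ρ)),
            l / 2 ≤ Φ z.1 z.2) := by
  sorry

/-- **STUB L22-B (N–U 2012 (3.3) / Seregin 2020 §3: the energy class of the normalised class-𝒱
pair across the axis and `S`; contract kits/A1-assembly-hEC.md).** [cite: Seregin2020, §3 pp. 9–10; NazarovUraltseva2012, (3.3), Remark 9] -/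
theorem stub_L22B_energyClass : ∀ (U U' : ℝ → EuclideanSpace ℝ (Fin 3) → EuclideanSpace ℝ (Fin 3)) (Φ Φ' : ℝ → EuclideanSpace ℝ (Fin 3) → ℝ)
      (S : Set (ℝ × EuclideanSpace ℝ (Fin 3))) (R k : ℝ) (N : ℝ≥0),
    ContinuousOn (uncurry U) {z : ℝ × EuclideanSpace ℝ (Fin 3) | z.1 < 0 ∧ cylRadius z.2 ≠ 0} →
    (∀ z : ℝ × EuclideanSpace ℝ (Fin 3), z.1 < 0 → cylRadius z.2 ≠ 0 → ContDiffAt ℝ (⊤ : ℕ∞) (U z.1) z.2) →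
    ContinuousOn (fun z : ℝ × EuclideanSpace ℝ (Fin 3) => fderiv ℝ (U z.1) z.2) {z : ℝ × EuclideanSpace ℝ (Fin 3) | z.1 < 0 ∧ cylRadius z.2 ≠ 0} →
    (∀ z : ℝ × EuclideanSpace ℝ (Fin 3), z.1 < 0 → cylRadius z.2 ≠ 0 → VectorCalculus.divergence (U z.1) z.2 = 0) →
    (∀ a : ℝ, 0 < a → ∫⁻ z in parabolicCylinder a (0 : ℝ × EuclideanSpace ℝ (Fin 3)), ‖U z.1 z.2‖ₑ ^ (3 : ℕ) < ∞) →
    IsClosed S → (∀ z ∈ S, z.1 ≤ 0 ∧ cylRadius z.2 = 0) → IsParabolicNull 1 S →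
    ContinuousOn (uncurry Φ) ({z : ℝ × EuclideanSpace ℝ (Fin 3) | z.1 < 0} \ S) →
    (∀ z : ℝ × EuclideanSpace ℝ (Fin 3), z.1 < 0 → z ∉ S → ContDiffAt ℝ (⊤ : ℕ∞) (Φ z.1) z.2) →
    ContinuousOn (fun z : ℝ × EuclideanSpace ℝ (Fin 3) => fderiv ℝ (Φ z.1) z.2) ({z : ℝ × EuclideanSpace ℝ (Fin 3) | z.1 < 0} \ S) →
    (∀ e : EuclideanSpace ℝ (Fin 3), ContinuousOn (fun z : ℝ × EuclideanSpace ℝ (Fin 3) => fderiv ℝ (fun y => fderiv ℝ (Φ z.1) y e) z.2 e)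
      ({z : ℝ × EuclideanSpace ℝ (Fin 3) | z.1 < 0} \ S)) →
    (∀ z : ℝ × EuclideanSpace ℝ (Fin 3), z.1 < 0 → cylRadius z.2 ≠ 0 → DifferentiableAt ℝ (fun r => Φ r z.2) z.1) →
    ContinuousOn (fun z : ℝ × EuclideanSpace ℝ (Fin 3) => deriv (fun r => Φ r z.2) z.1)
      {z : ℝ × EuclideanSpace ℝ (Fin 3) | z.1 < 0 ∧ cylRadius z.2 ≠ 0} →
    (∀ δ' ρ : ℝ, 0 < δ' → δ' < ρ → ∃ C : ℝ, ∀ z : ℝ × EuclideanSpace ℝ (Fin 3),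
      z.1 ∈ Ioo (-ρ ^ 2) 0 → δ' < cylRadius z.2 → cylRadius z.2 < ρ → |z.2 2| < ρ →
        |deriv (fun r => Φ r z.2) z.1| ≤ C ∧ ‖fderiv ℝ (Φ z.1) z.2‖ ≤ C ∧
        ∀ e : EuclideanSpace ℝ (Fin 3), ‖e‖ ≤ 1 → |fderiv ℝ (fun y => fderiv ℝ (Φ z.1) y e) z.2 e| ≤ C) →
    (∃ B : ℝ, ∀ z : ℝ × EuclideanSpace ℝ (Fin 3), z.1 < 0 → z ∉ S → |Φ z.1 z.2| ≤ B) →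
    (∀ z : ℝ × EuclideanSpace ℝ (Fin 3), z.1 < 0 → z ∉ S → 0 ≤ Φ z.1 z.2) →
    (∀ z : ℝ × EuclideanSpace ℝ (Fin 3), z.1 < 0 → cylRadius z.2 ≠ 0 →
      0 ≤ deriv (fun r => Φ r z.2) z.1 + fderiv ℝ (Φ z.1) z.2 (U z.1 z.2) +
          2 / cylRadius z.2 * partialDeriv (eR z.2) (Φ z.1) z.2 - (Laplacian.laplacian (Φ z.1)) z.2) →
    0 < R → 0 < k →
    (∫⁻ s in Ioo (-R ^ 2) 0, (∫⁻ y in ball (0 : EuclideanSpace ℝ (Fin 3)) (2 * R), ‖U s y‖ₑ ^ (3 : ℕ)) ^ (4 / 3 : ℝ) ≤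
      (N : ℝ≥0∞) * ENNReal.ofReal R ^ 2) →
    (∀ z : ℝ × EuclideanSpace ℝ (Fin 3), z.1 ∈ Ioo (-R ^ 2) 0 → cylRadius z.2 = 0 →
      z.2 2 ∈ Ioo (-(2 * R)) (2 * R) → z ∉ S → k ≤ Φ z.1 z.2) →
    (∀ t x, t < 0 → (t, x) ∉ S → Φ' t x = Φ t x) → (∀ t x, ¬ (t < 0 ∧ (t, x) ∉ S) → Φ' t x = k) →
    (∀ t x, t < 0 → cylRadius x ≠ 0 → U' t x = U t x) → (∀ t x, ¬ (t < 0 ∧ cylRadius x ≠ 0) → U' t x = 0) →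
    (∀ (H : ℝ → ℝ), ContDiff ℝ 2 H → (∀ v, deriv H v ≤ 0) → (∀ v, 0 ≤ H v) → (∀ v, 0 ≤ deriv
          (deriv H) v) → (∀ v, deriv H v ^ 2 ≤ 2 * H v * deriv (deriv H) v) → (∀ v, k ≤ v → H v = 0)
          → ∀ (Θ : EuclideanSpace ℝ (Fin 3) → ℝ), ContDiff ℝ 1 Θ → HasCompactSupport Θ → tsupport Θ
          ⊆ ball (0 : EuclideanSpace ℝ (Fin 3)) (2 * R) → ∀ (η : ℝ → ℝ), ContDiff ℝ 1 η → (∀ s, 0 ≤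
          η s) → ∀ (t₁ t₂ : ℝ), -R ^ 2 < t₁ → t₁ ≤ t₂ → t₂ < 0 → ENNReal.ofReal (η t₂ * ∫ x, H (Φ' t₂
          x) * Θ x ^ 2) + ∫⁻ z in Icc t₁ t₂ ×ˢ (univ : Set (EuclideanSpace ℝ (Fin 3))),
          ENNReal.ofReal (1 / 2 * η z.1 * (deriv (deriv H) (Φ' z.1 z.2) * ‖gradient (Φ' z.1) z.2‖ ^ 2
          * Θ z.2 ^ 2)) ≤ ENNReal.ofReal (η t₁ * (∫ x, H (Φ' t₁ x) * Θ x ^ 2) + (4 * ∫ z in Icc t₁ t₂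
          ×ˢ (univ : Set (EuclideanSpace ℝ (Fin 3))), η z.1 * (H (Φ' z.1 z.2) * ‖gradient Θ z.2‖ ^
          2)) + (∫ z in Icc t₁ t₂ ×ˢ (univ : Set (EuclideanSpace ℝ (Fin 3))), η z.1 * (H (Φ' z.1 z.2)
          * inner ℝ (U' z.1 z.2) (gradient (fun y => Θ y ^ 2) z.2))) + (∫ z in Icc t₁ t₂ ×ˢ (univ :
          Set (EuclideanSpace ℝ (Fin 3))), η z.1 * (2 / cylRadius z.2 * (H (Φ' z.1 z.2) * fderiv ℝ
          (fun y => Θ y ^ 2) z.2 (eR z.2)))) + (∫ z in Icc t₁ t₂ ×ˢ (univ : Set (EuclideanSpace ℝ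
          (Fin 3))), |deriv η z.1| * (H (Φ' z.1 z.2) * Θ z.2 ^ 2)))) := by
  sorry

/-- **Lemma 2.2 from the two stubs** (= `hWH′`, byte for byte), through the landed assembly. [cite: Seregin2020, Lemma 2.2] -/
theorem lemma22_of_stubs :
    ∀ (M : ℝ) (N : ℝ≥0), ∃ β : ℝ, 0 < β ∧
  ∀ (u U : ℝ → EuclideanSpace ℝ (Fin 3) → EuclideanSpace ℝ (Fin 3))
    (p : ℝ → EuclideanSpace ℝ (Fin 3) → ℝ) (K : ℝ≥0)
    (Φ : ℝ → EuclideanSpace ℝ (Fin 3) → ℝ) (S : Set (ℝ × EuclideanSpace ℝ (Fin 3))) (R k : ℝ),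
    (∀ s, IsAxisymmetric (u s)) → (∀ s, IsAxisymmetricScalar (p s)) →
    (∀ a : ℝ, 0 < a →
      IsSuitableWeakSolutionInBall a 0 u p ∧
      cknAEss a 0 u ≤ K ∧
      cknC a 0 u ≤ K ∧
      cknD a 0 p ≤ K ∧
      ∃ G' : ℝ → EuclideanSpace ℝ (Fin 3) →
          EuclideanSpace ℝ (Fin 3) →L[ℝ] EuclideanSpace ℝ (Fin 3),
        HasWeakSpatialGradientOn (parabolicCylinderOpens (2 * a) 0) u G' ∧
          cknAEss a 0 u + cknE a 0 G' ≤ K) →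
    uncurry u =ᵐ[volume.restrict {z : ℝ × EuclideanSpace ℝ (Fin 3) | z.1 < 0}] uncurry U →
    ContinuousOn (uncurry U)
      {z : ℝ × EuclideanSpace ℝ (Fin 3) | z.1 < 0 ∧ cylRadius z.2 ≠ 0} →
    (∀ z : ℝ × EuclideanSpace ℝ (Fin 3), z.1 < 0 → cylRadius z.2 ≠ 0 →
      ContDiffAt ℝ (⊤ : ℕ∞) (U z.1) z.2) →
    ContinuousOn (fun z : ℝ × EuclideanSpace ℝ (Fin 3) => fderiv ℝ (U z.1) z.2)
      {z : ℝ × EuclideanSpace ℝ (Fin 3) | z.1 < 0 ∧ cylRadius z.2 ≠ 0} →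
    (∀ z : ℝ × EuclideanSpace ℝ (Fin 3), z.1 < 0 → cylRadius z.2 ≠ 0 →
      VectorCalculus.divergence (U z.1) z.2 = 0) →
    IsClosed S → (∀ z ∈ S, z.1 ≤ 0 ∧ cylRadius z.2 = 0) → IsParabolicNull 1 S →
    ContinuousOn (uncurry Φ) ({z : ℝ × EuclideanSpace ℝ (Fin 3) | z.1 < 0} \ S) →
    (∀ z : ℝ × EuclideanSpace ℝ (Fin 3), z.1 < 0 → z ∉ S →
      ContDiffAt ℝ (⊤ : ℕ∞) (Φ z.1) z.2) →
    ContinuousOn (fun z : ℝ × EuclideanSpace ℝ (Fin 3) => fderiv ℝ (Φ z.1) z.2)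
      ({z : ℝ × EuclideanSpace ℝ (Fin 3) | z.1 < 0} \ S) →
    (∀ e : EuclideanSpace ℝ (Fin 3), ContinuousOn (fun z : ℝ × EuclideanSpace ℝ (Fin 3) =>
        fderiv ℝ (fun y => fderiv ℝ (Φ z.1) y e) z.2 e)
      ({z : ℝ × EuclideanSpace ℝ (Fin 3) | z.1 < 0} \ S)) →
    (∀ z : ℝ × EuclideanSpace ℝ (Fin 3), z.1 < 0 → cylRadius z.2 ≠ 0 →
      DifferentiableAt ℝ (fun r => Φ r z.2) z.1) →
    ContinuousOn (fun z : ℝ × EuclideanSpace ℝ (Fin 3) => deriv (fun r => Φ r z.2) z.1)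
      {z : ℝ × EuclideanSpace ℝ (Fin 3) | z.1 < 0 ∧ cylRadius z.2 ≠ 0} →
    (∀ δ ρ : ℝ, 0 < δ → δ < ρ → ∃ C : ℝ, ∀ z : ℝ × EuclideanSpace ℝ (Fin 3),
      z.1 ∈ Ioo (-ρ ^ 2) 0 → δ < cylRadius z.2 → cylRadius z.2 < ρ → |z.2 2| < ρ →
        |deriv (fun r => Φ r z.2) z.1| ≤ C ∧ ‖fderiv ℝ (Φ z.1) z.2‖ ≤ C ∧
        ∀ e : EuclideanSpace ℝ (Fin 3), ‖e‖ ≤ 1 →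
          |fderiv ℝ (fun y => fderiv ℝ (Φ z.1) y e) z.2 e| ≤ C) →
    (∃ B : ℝ, ∀ z : ℝ × EuclideanSpace ℝ (Fin 3), z.1 < 0 → z ∉ S → |Φ z.1 z.2| ≤ B) →
    (∀ z : ℝ × EuclideanSpace ℝ (Fin 3), z.1 < 0 → z ∉ S → 0 ≤ Φ z.1 z.2) →
    (∀ z : ℝ × EuclideanSpace ℝ (Fin 3), z.1 < 0 → cylRadius z.2 ≠ 0 →
      0 ≤ deriv (fun r => Φ r z.2) z.1 + fderiv ℝ (Φ z.1) z.2 (U z.1 z.2) +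
          2 / cylRadius z.2 * partialDeriv (eR z.2) (Φ z.1) z.2 - (Laplacian.laplacian (Φ z.1)) z.2) →
    0 < R → 0 < k → 1 ≤ M →
    (∫⁻ s in Ioo (-R ^ 2) 0, (∫⁻ y in ball (0 : EuclideanSpace ℝ (Fin 3)) (2 * R),
        ‖u s y‖ₑ ^ (3 : ℕ)) ^ (4 / 3 : ℝ) ≤ (N : ℝ≥0∞) * ENNReal.ofReal R ^ 2) →
    (∀ z : ℝ × EuclideanSpace ℝ (Fin 3), z.1 ∈ Ioo (-R ^ 2) 0 → cylRadius z.2 = 0 →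
      z.2 2 ∈ Ioo (-(2 * R)) (2 * R) → z ∉ S → k ≤ Φ z.1 z.2) →
    (∀ z : ℝ × EuclideanSpace ℝ (Fin 3), z.1 ∈ Ioo (-R ^ 2) 0 →
      z.2 ∈ ball (0 : EuclideanSpace ℝ (Fin 3)) (2 * R) → z ∉ S → Φ z.1 z.2 ≤ M * k) →
    ∀ᵐ z ∂(volume.restrict (parabolicCylinder (R / 2) (0 : ℝ × EuclideanSpace ℝ (Fin 3)))),
      β * k ≤ Φ z.1 z.2 :=
  lemma22_of_moser_and_energyClass stub_L31_moserSublevel stub_L22B_energyClass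

/-- **The named fact from the two stubs** (composition check): Seregin 2020, Thm 2.1. [cite: Seregin2020, Thm 2.1] -/
theorem seregin2020_typeII_of_stubs : Seregin2020_axisymmetricSingularPoint_typeII :=
  seregin2020_typeII_of_moser_and_energyClass stub_L31_moserSublevel stub_L22B_energyClass

end Summit.NavierStokesRegularity.NavierStokesRegularity.Theorems.AxisymmetricKatoGlobal.EulerScaling

end
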